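import Literature.AlgebraicGeometry.Motives.TateConjectureStrongFormFiniteField
import Literature.AlgebraicGeometry.Motives.StandardConjecturesRationalStructureProofs
import HarnessLib

/-!
# `E ⟹ I`: rational algebraic classes are a `ℚ`-structure — the `ℚ`-structure clause of Tate's
# theorem over a finite field (Milne 2007 Th. 1.2; Tate 1994 Th. 2.9; Kleiman 1968 Thm. 3.5)

Topic `Literature/AlgebraicGeometry/Motives`; THEOREMS ONLY (no definition, no named fact).

J. S. Milne, *The Tate conjecture over finite fields (AIM talk)*, arXiv:0709.3040, §1 Th. 1.2
(held, p. 4): «Let `X` be a variety over `𝔽` of dimension `d`, and let `r ∈ ℕ`. The following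
statements are equivalent: (a) `T^r(X, ℓ)` and `E^r(X, ℓ)` are true for a single `ℓ`. (b) `T^r`,
`S^r`, and `T^{d-r}` are true for a single `ℓ`. (c) `T^r`, `E^r`, `S^r`, `T^{d-r}`, and `E^{d-r}`
are true for all `ℓ`, **and the `ℚ`-subspace `𝒜^r_ℓ(X)` of `𝒯^r_ℓ(X)` generated by the algebraic
classes is a `ℚ`-structure on `𝒯^r_ℓ(X)`, i.e., `𝒜^r_ℓ(X) ⊗_ℚ ℚ_ℓ ≃ 𝒯^r_ℓ(X)`**. (d) the order of
the pole of `Z(X, t)` at `t = q^{-r}` is equal to the rank of the group of numerical equivalence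
classes of algebraic cycles of codimension `r`. The proof is explained in [Tate 1994], 2.» Here
`E^r(X, ℓ)`: «The kernel of the cycle class map `c^r : Z^r(X) → H^{2r}(X_𝔽, ℚ_ℓ(r))` consists
exactly of the cycles numerically equivalent to zero» (p. 3), and `𝒯^r` = the Tate classes.
The surjectivity half of the `ℚ`-structure statement is `T^r`; the injectivity half — Tate's
`I^r(X)`: `𝒜^r ⊗_ℚ ℚ_ℓ → H^{2r}` is injective, i.e. **`ℚ`-linearly independent algebraic classes are
`ℚ_ℓ`-linearly independent** — follows from `E^r` by pairing with dual classes of complementary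
codimension, whose intersection numbers are rational (S. Kleiman, *Algebraic cycles and the Weil
conjectures* (1968), §3 Thm. 3.5: cycles modulo numerical equivalence form finite-dimensional
`ℚ`-spaces in perfect duality; B. Kahn, *Zeta and L-functions of varieties and motives* (2020),
§6.2 Th. 6.4 (2), held p0116–p0117: «the pairing `A ⊗_Z F × B ⊗_Z F → F` induced by the
intersection product is nondegenerate»).

The equivalences (a) ⟺ (b) ⟺ (d) are the tree's `GaloisWeilCohomology.tate_a_iff_b`,
`rank_eq_finrank_maxGenEigenspace_iff`, `hasPoleOfOrderAt_zetaSeries_rank_iff`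
(`Motives/TateConjectureStrongFormFiniteField`, `Motives/ZetaFunctionPoleOrderTateConjecture`). This
file adds the `ℚ`-STRUCTURE clause of (c), for the tree's abstract Weil cohomology theories with
coefficient field `K ⊇ ℚ` (`ℚ_ℓ` in the source):

* §1 (pure linear algebra, namespace `RatStructure`, continuing
  `Motives/StandardConjecturesRationalStructureProofs`): for a `K`-bilinear `B : V × V' → K` and
  `ℚ`-subspaces `S ⊆ V`, `S' ⊆ V'` with `B(S, S') ⊆ ℚ` and `B(s, S') = 0 ⇒ s = 0` on `S`,
  **`ℚ`-linearly independent families in `S` are `K`-linearly independent**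
  (`linearIndependent_of_isRatValued`: for a finite relation `Σ g_j a_j = 0`, `g_j ∈ K`, the
  `ℚ`-linear map `S' → ℚ^s`, `y ↦ (B(a_j, y))_j`, is onto — a rational linear form vanishing on its
  image gives a `ℚ`-class `Σ λ_j a_j ∈ S` orthogonal to `S'`, hence zero by the kernel hypothesis,
  hence `λ = 0` — so there are `y_i ∈ S'` with `B(a_j, y_i) = δ_{ji}`, and pairing the relation with
  `y_i` gives `g_i = 0`); every `ℚ`-basis of `S` is `K`-linearly independent
  (`linearIndependent_basis_of_isRatValued`) and **`dim_ℚ S = dim_K (K · S)`**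
  (`finrank_eq_finrank_span_of_isRatValued`): `S` is a `ℚ`-structure on its `K`-span.
* §2 (any Weil cohomology theory `W`, any field): **`E ⟹ I`** — if the Poincaré pairing
  `Aᵖ(Y)_ℚ × A^q(Y)_ℚ → K` (`p + q = dim Y`) has trivial left kernel, then `ℚ`-linearly independent
  rational algebraic classes in `H²ᵖ(Y)` are `K`-linearly independent
  (`linearIndependent_of_mem_ratAlgebraicClasses`; `ℚ`-independence is spelled with rational
  scalars `((c i : ℚ) : K)`, the tree's `Aᵖ(Y)_ℚ = W.ratAlgebraicClasses Y p` being an additive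
  subgroup of the `K`-space `H²ᵖ(Y)`), and `K · Aᵖ(Y)` has a `K`-basis of `ℚ`-classes which
  `ℚ`-spans `Aᵖ(Y)_ℚ` (`exists_ratBasis_algebraicClasses`: `Aᵖ(Y)_ℚ ⊗_ℚ K ≃ K · Aᵖ(Y)`).
* §3 (`k` finite, Galois Weil cohomology `E`): **Milne 2007 Th. 1.2, clause (c)**: under Tate's
  (a) [`T^r`: `K · A^r(X) = Ker(φ_r - 1)` on `H^{2r}(X)`, `φ_r = χ(F)^r F`, and `E^r`] the rational
  algebraic classes are a `ℚ`-structure on the Tate classes `Ker(φ_r - 1)`: a `K`-basis of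
  `Ker(φ_r - 1)` made of `ℚ`-algebraic classes `ℚ`-spanning `A^r(X)_ℚ`
  (`exists_ratBasis_ker_of_tate_a`), and `I^r` (`linearIndependent_of_tate_a`).

## Provenance

Lane `lit-hodgefound` (summit `HodgeConjecture`, Track 2 foundations library, Layer B: motives),
seat `lit-hodgefound-p29` (literature-prover, generation 37, row g37-#8).
-/

universe u v

open CategoryTheory AlgebraicGeometry

noncomputable section

namespace Literature.AlgebraicGeometry.Motives

/-! ## §1 (pure) `ℚ`-linearly independent ⟹ `K`-linearly independent -/

namespace RatStructure

variable {K : Type*} [Field K] [CharZero K]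
variable {V : Type*} [AddCommGroup V] [Module K V] [Module ℚ V] [IsScalarTower ℚ K V]
variable {V' : Type*} [AddCommGroup V'] [Module K V'] [Module ℚ V'] [IsScalarTower ℚ K V']

/-- **`I` from `E` — `ℚ`-linearly independent elements of a rational structure are `K`-linearly
independent.** Let `B : V × V' → K` be `K`-bilinear over a field `K ⊇ ℚ`, and `S ⊆ V`, `S' ⊆ V'`
`ℚ`-subspaces with `B(S, S') ⊆ ℚ` and `B(s, S') = 0 ⇒ s = 0` for `s ∈ S` (numerical triviality
against `S'` detects `0` on `S`). Then every `ℚ`-linearly independent family in `S` is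
`K`-linearly independent («`𝒜^r_ℓ(X) ⊗_ℚ ℚ_ℓ ≃ 𝒯^r_ℓ(X)`», injectivity; Kleiman: perfect duality of
cycles modulo numerical equivalence). Proof in the module docstring (dual classes `y_i ∈ S'` with
`B(a_j, y_i) = δ_{ji}`). [cite: Milne2007TateFiniteFieldsAIM, §1 Th. 1.2 (c)]
[cite: Kleiman1968AlgebraicCycles, §3 Thm. 3.5] [cite: Kahn2020, §6.2 Th. 6.4 (2)] -/
theorem linearIndependent_of_isRatValued (B : V →ₗ[K] V' →ₗ[K] K) (S : Submodule ℚ V)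
    (S' : Submodule ℚ V') (hrat : ∀ s ∈ S, ∀ s' ∈ S', ∃ r : ℚ, B s s' = r)
    (hS : ∀ s ∈ S, (∀ s' ∈ S', B s s' = 0) → s = 0) {ι : Type*} {a : ι → V}
    (ha : ∀ i, a i ∈ S) (hli : LinearIndependent ℚ a) : LinearIndependent K a := by
  classical
  obtain ⟨φ, hφ⟩ := exists_ratRetraction (K := K)
  rw [linearIndependent_iff']
  intro s g hg i hi
  -- the `ℚ`-linear map `T : V' → ℚ^s`, `y ↦ (φ (B (a j) y))_{j ∈ s}`
  let T : V' →ₗ[ℚ] (s → ℚ) :=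
    { toFun := fun y j ↦ φ (B (a j) y)
      map_add' := fun y y' ↦ by
        funext j
        simp only [map_add, Pi.add_apply]
      map_smul' := fun r y ↦ by
        funext j
        simp only [RingHom.id_apply, Pi.smul_apply]
        rw [pairing_ratSmul_right, map_smul] }
  have hT : ∀ y (j : s), T y j = φ (B (a j) y) := fun _ _ ↦ rfl
  have hratj : ∀ y ∈ S', ∀ j : ι, ∃ r : ℚ, B (a j) y = r := fun y hy j ↦ hrat _ (ha j) _ hy
  -- Step 1: `T` maps `S'` ONTO `ℚ^s`
  have htop : S'.map T = ⊤ := by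
    by_contra hne
    obtain ⟨f, hf0, hf⟩ := Submodule.exists_le_ker_of_lt_top _ (lt_top_iff_ne_top.mpr hne)
    set lam : s → ℚ := fun j ↦ f fun l ↦ if j = l then 1 else 0 with hlam
    have hfapply : ∀ v : s → ℚ, f v = ∑ j, v j * lam j := fun v ↦ by
      rw [LinearMap.pi_apply_eq_sum_univ f v]
      rfl
    -- the `ℚ`-class `x = Σ λ_j a_j ∈ S` pairs to zero with `S'`
    set x : V := ∑ j : s, lam j • a j with hx
    have hxS : x ∈ S := S.sum_mem fun j _ ↦ S.smul_mem _ (ha j)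
    have hx0 : x = 0 := by
      refine hS x hxS fun y hy ↦ ?_
      choose r hr using hratj y hy
      have hfy : f (T y) = 0 := LinearMap.mem_ker.mp (hf (Submodule.mem_map_of_mem hy))
      rw [hfapply] at hfy
      have hfy' : ∑ j : s, r j * lam j = 0 := by
        simpa only [hT, hr, hφ] using hfy
      calc B x y = ∑ j : s, lam j • B (a j) y := by
            rw [hx, map_sum, LinearMap.sum_apply]
            exact Finset.sum_congr rfl fun j _ ↦ by rw [pairing_ratSmul_left]
        _ = ((∑ j : s, r j * lam j : ℚ) : K) := by
            rw [Rat.cast_sum]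
            exact Finset.sum_congr rfl fun j _ ↦ by rw [hr, Rat.smul_def, Rat.cast_mul, mul_comm]
        _ = 0 := by rw [hfy', Rat.cast_zero]
    -- hence `λ = 0` by the `ℚ`-independence of `a`, and `f = 0`
    have hlam0 : ∀ j, lam j = 0 :=
      Fintype.linearIndependent_iff.mp (hli.comp ((↑) : s → ι) Subtype.val_injective) lam (by
        show ∑ j : s, lam j • a (j : ι) = 0
        rw [← hx]
        exact hx0)
    apply hf0
    refine LinearMap.ext fun v ↦ ?_
    rw [hfapply, LinearMap.zero_apply]
    exact Finset.sum_eq_zero fun j _ ↦ by rw [hlam0 j, mul_zero]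
  -- Step 2: a class `y ∈ S'` dual to `a i` among the `a j`, `j ∈ s`
  obtain ⟨y, hyS', hTy⟩ : ∃ y ∈ S', T y = fun l ↦ if l = ⟨i, hi⟩ then 1 else 0 := by
    have hmem : (fun l : s ↦ if l = ⟨i, hi⟩ then (1 : ℚ) else 0) ∈ S'.map T := by
      rw [htop]
      exact Submodule.mem_top
    exact Submodule.mem_map.mp hmem
  choose r hr using hratj y hyS'
  have hy : ∀ j ∈ s, B (a j) y = if j = i then 1 else 0 := fun j hj ↦ by
    have hj' := congr_fun hTy ⟨j, hj⟩
    rw [hT, hr, hφ] at hj'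
    simp only [Subtype.mk.injEq] at hj'
    rw [hr, hj']
    split_ifs <;> simp
  -- Step 3: pair the relation `Σ g_j a_j = 0` with `y`
  have hsum : ∀ j ∈ s, B (g j • a j) y = if j = i then g j else 0 := fun j hj ↦ by
    rw [map_smul, LinearMap.smul_apply, hy j hj, smul_eq_mul, mul_ite, mul_one, mul_zero]
  have key : B (∑ j ∈ s, g j • a j) y = g i := by
    rw [map_sum, LinearMap.sum_apply, Finset.sum_congr rfl hsum, Finset.sum_ite_eq', if_pos hi]
  rw [hg, map_zero, LinearMap.zero_apply] at key
  exact key.symm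

/-- **Every `ℚ`-basis of `S` is `K`-linearly independent** (under the hypotheses of
`linearIndependent_of_isRatValued`). [cite: Milne2007TateFiniteFieldsAIM, §1 Th. 1.2 (c)]
[cite: Kleiman1968AlgebraicCycles, §3 Thm. 3.5] -/
theorem linearIndependent_basis_of_isRatValued (B : V →ₗ[K] V' →ₗ[K] K) (S : Submodule ℚ V)
    (S' : Submodule ℚ V') (hrat : ∀ s ∈ S, ∀ s' ∈ S', ∃ r : ℚ, B s s' = r)
    (hS : ∀ s ∈ S, (∀ s' ∈ S', B s s' = 0) → s = 0) {ι : Type*} (b : Module.Basis ι ℚ S) :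
    LinearIndependent K fun i ↦ ((b i : S) : V) :=
  linearIndependent_of_isRatValued B S S' hrat hS (fun i ↦ (b i).2)
    (b.linearIndependent.map' S.subtype S.ker_subtype)

/-- **`S` is a `ℚ`-structure on its `K`-span: `dim_ℚ S = dim_K (K · S)`** (under the hypotheses
of `linearIndependent_of_isRatValued`, with `V'` finite dimensional so that `S` is finite
dimensional over `ℚ`, `finite_of_isRatValued`): a `ℚ`-basis of `S` is a `K`-basis of `span_K S`
(«`𝒜 ⊗_ℚ ℚ_ℓ ≃` its span»). [cite: Milne2007TateFiniteFieldsAIM, §1 Th. 1.2 (c)]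
[cite: Kleiman1968AlgebraicCycles, §3 Thm. 3.5] [cite: Kahn2020, §6.2 Th. 6.4 (2)] -/
theorem finrank_eq_finrank_span_of_isRatValued [FiniteDimensional K V'] (B : V →ₗ[K] V' →ₗ[K] K)
    (S : Submodule ℚ V) (S' : Submodule ℚ V') (hrat : ∀ s ∈ S, ∀ s' ∈ S', ∃ r : ℚ, B s s' = r)
    (hS : ∀ s ∈ S, (∀ s' ∈ S', B s s' = 0) → s = 0) :
    Module.finrank ℚ S = Module.finrank K (Submodule.span K (S : Set V)) := by
  haveI := finite_of_isRatValued B S S' hrat hS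
  let b := Module.finBasis ℚ S
  have hK := linearIndependent_basis_of_isRatValued B S S' hrat hS b
  have hspan : Submodule.span K (Set.range fun i ↦ ((b i : S) : V)) =
      Submodule.span K (S : Set V) := by
    refine le_antisymm (Submodule.span_mono (Set.range_subset_iff.mpr fun i ↦ (b i).2))
      (Submodule.span_le.mpr fun s hs ↦ ?_)
    have hrepr := congrArg Subtype.val (b.sum_repr ⟨s, hs⟩)
    rw [AddSubmonoidClass.coe_finsetSum, Subtype.coe_mk] at hrepr
    rw [SetLike.mem_coe, ← hrepr]
    refine Submodule.sum_mem _ fun i _ ↦ ?_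
    rw [Submodule.coe_smul, ← algebraMap_smul K (b.repr ⟨s, hs⟩ i)]
    exact Submodule.smul_mem _ _ (Submodule.subset_span ⟨i, rfl⟩)
  rw [Module.finrank_eq_card_basis b, ← hspan, finrank_span_eq_card hK]

end RatStructure

/-! ## §2 `E ⟹ I` for a Weil cohomology theory -/

namespace WeilCohomology

variable {k : Type u} [Field k] {K : Type v} [Field K] [CharZero K] (W : WeilCohomology k K)
variable {N : ℕ} {Y : SchemeOver k}

/-- **`E ⟹ I` (Tate): `ℚ`-linearly independent rational algebraic classes are `K`-linearly
independent.** For `Y` smooth projective of dimension `N`, `p + q = N`: if the Poincaré pairing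
`Aᵖ(Y)_ℚ × A^q(Y)_ℚ → K` has trivial left kernel («the kernel of the cycle class map consists
exactly of the cycles numerically equivalent to zero», `E`), then a family of `ℚ`-algebraic
classes in `H²ᵖ(Y)` without non-trivial RATIONAL linear relation has no non-trivial `K`-linear
relation — the cycle class map `Aᵖ(Y)_ℚ ⊗_ℚ K → H²ᵖ(Y)` is injective (`I`). (From
`RatStructure.linearIndependent_of_isRatValued`, the rationality of intersection numbers
`exists_rat_cupPairing_of_mem_ratAlgebraicClasses`, and the `ℚ`-structure of `H²ᵖ(Y)` by
restriction of scalars.) [cite: Milne2007TateFiniteFieldsAIM, §1 Th. 1.2 (c)]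
[cite: Kleiman1968AlgebraicCycles, §3 Thm. 3.5] [cite: Kahn2020, §6.2 Th. 6.4 (2)] -/
theorem linearIndependent_of_mem_ratAlgebraicClasses (hY : IsSmoothProjective N Y) {p q : ℕ}
    (hpq : p + q = N) (h : 2 * p + 2 * q = 2 * N)
    (hD : ∀ x ∈ W.ratAlgebraicClasses Y p,
      (∀ y ∈ W.ratAlgebraicClasses Y q, W.cupPairing Y N (2 * p) (2 * q) h x y = 0) → x = 0)
    {ι : Type*} {a : ι → W.obj Y (2 * p)} (ha : ∀ i, a i ∈ W.ratAlgebraicClasses Y p)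
    (hind : ∀ (s : Finset ι) (c : ι → ℚ), ∑ i ∈ s, ((c i : ℚ) : K) • a i = 0 → ∀ i ∈ s, c i = 0) :
    LinearIndependent K a := by
  -- `ℚ`-vector space structures on `H²ᵖ(Y)`, `H²ᵠ(Y)` by restriction of scalars
  letI iP : Module ℚ (W.obj Y (2 * p)) := Module.compHom _ (algebraMap ℚ K)
  letI iQ : Module ℚ (W.obj Y (2 * q)) := Module.compHom _ (algebraMap ℚ K)
  haveI : IsScalarTower ℚ K (W.obj Y (2 * p)) :=
    ⟨fun r c x ↦ show ((r • c : K)) • x = (algebraMap ℚ K r) • (c • x) by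
      rw [Algebra.smul_def, mul_smul]⟩
  haveI : IsScalarTower ℚ K (W.obj Y (2 * q)) :=
    ⟨fun r c x ↦ show ((r • c : K)) • x = (algebraMap ℚ K r) • (c • x) by
      rw [Algebra.smul_def, mul_smul]⟩
  -- the rational algebraic classes as `ℚ`-subspaces
  let SP : Submodule ℚ (W.obj Y (2 * p)) :=
    { carrier := W.ratAlgebraicClasses Y p
      add_mem' := fun ha hb ↦ add_mem ha hb
      zero_mem' := zero_mem _
      smul_mem' := fun r x hx ↦ by
        change (algebraMap ℚ K r) • x ∈ W.ratAlgebraicClasses Y p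
        rw [eq_ratCast]
        exact W.ratCast_smul_mem_ratAlgebraicClasses hx r }
  let SQ : Submodule ℚ (W.obj Y (2 * q)) :=
    { carrier := W.ratAlgebraicClasses Y q
      add_mem' := fun ha hb ↦ add_mem ha hb
      zero_mem' := zero_mem _
      smul_mem' := fun r x hx ↦ by
        change (algebraMap ℚ K r) • x ∈ W.ratAlgebraicClasses Y q
        rw [eq_ratCast]
        exact W.ratCast_smul_mem_ratAlgebraicClasses hx r }
  have hrat : ∀ s ∈ SP, ∀ s' ∈ SQ, ∃ r : ℚ, W.cupPairing Y N (2 * p) (2 * q) h s s' = r :=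
    fun s hs s' hs' ↦ W.exists_rat_cupPairing_of_mem_ratAlgebraicClasses hY hpq h hs hs'
  have hS : ∀ s ∈ SP, (∀ s' ∈ SQ, W.cupPairing Y N (2 * p) (2 * q) h s s' = 0) → s = 0 :=
    fun s hs hperp ↦ hD s hs hperp
  have hli : LinearIndependent ℚ a := by
    refine linearIndependent_iff'.mpr fun s c hc ↦ hind s c ?_
    rw [← hc]
    exact Finset.sum_congr rfl fun i _ ↦ by rw [← algebraMap_smul K (c i) (a i), eq_ratCast]
  exact RatStructure.linearIndependent_of_isRatValued (W.cupPairing Y N (2 * p) (2 * q) h) SP SQ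
    hrat hS ha hli

/-- **`E ⟹ Aᵖ(Y)_ℚ ⊗_ℚ K ≃ K · Aᵖ(Y)`**: under `E` in bidegree `(p, q)` (`p + q = dim Y`) there
is a `K`-BASIS `a₁, …, a_m` of `K · Aᵖ(Y)` consisting of `ℚ`-algebraic classes such that every
`ℚ`-algebraic class is a RATIONAL linear combination of the `a_i` (a `ℚ`-basis of `Aᵖ(Y)_ℚ` is a
`K`-basis of `K · Aᵖ(Y)`; `m = dim_K (K · Aᵖ(Y)) = dim_ℚ Aᵖ(Y)_ℚ`).
[cite: Milne2007TateFiniteFieldsAIM, §1 Th. 1.2 (c)] [cite: Kleiman1968AlgebraicCycles, §3 Thm. 3.5]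
[cite: Kahn2020, §6.2 Th. 6.4 (2)] -/
theorem exists_ratBasis_algebraicClasses (hY : IsSmoothProjective N Y) {p q : ℕ}
    (hpq : p + q = N) (h : 2 * p + 2 * q = 2 * N)
    (hD : ∀ x ∈ W.ratAlgebraicClasses Y p,
      (∀ y ∈ W.ratAlgebraicClasses Y q, W.cupPairing Y N (2 * p) (2 * q) h x y = 0) → x = 0) :
    ∃ (m : ℕ) (a : Fin m → W.obj Y (2 * p)), (∀ i, a i ∈ W.ratAlgebraicClasses Y p) ∧
      LinearIndependent K a ∧ Submodule.span K (Set.range a) = W.algebraicClasses Y p ∧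
      (∀ x ∈ W.ratAlgebraicClasses Y p, ∃ c : Fin m → ℚ, x = ∑ i, ((c i : ℚ) : K) • a i) ∧
      m = Module.finrank K (W.algebraicClasses Y p) := by
  letI iP : Module ℚ (W.obj Y (2 * p)) := Module.compHom _ (algebraMap ℚ K)
  letI iQ : Module ℚ (W.obj Y (2 * q)) := Module.compHom _ (algebraMap ℚ K)
  haveI : IsScalarTower ℚ K (W.obj Y (2 * p)) :=
    ⟨fun r c x ↦ show ((r • c : K)) • x = (algebraMap ℚ K r) • (c • x) by
      rw [Algebra.smul_def, mul_smul]⟩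
  haveI : IsScalarTower ℚ K (W.obj Y (2 * q)) :=
    ⟨fun r c x ↦ show ((r • c : K)) • x = (algebraMap ℚ K r) • (c • x) by
      rw [Algebra.smul_def, mul_smul]⟩
  haveI := W.finite_obj hY (2 * q)
  let SP : Submodule ℚ (W.obj Y (2 * p)) :=
    { carrier := W.ratAlgebraicClasses Y p
      add_mem' := fun ha hb ↦ add_mem ha hb
      zero_mem' := zero_mem _
      smul_mem' := fun r x hx ↦ by
        change (algebraMap ℚ K r) • x ∈ W.ratAlgebraicClasses Y p
        rw [eq_ratCast]
        exact W.ratCast_smul_mem_ratAlgebraicClasses hx r }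
  let SQ : Submodule ℚ (W.obj Y (2 * q)) :=
    { carrier := W.ratAlgebraicClasses Y q
      add_mem' := fun ha hb ↦ add_mem ha hb
      zero_mem' := zero_mem _
      smul_mem' := fun r x hx ↦ by
        change (algebraMap ℚ K r) • x ∈ W.ratAlgebraicClasses Y q
        rw [eq_ratCast]
        exact W.ratCast_smul_mem_ratAlgebraicClasses hx r }
  have hrat : ∀ s ∈ SP, ∀ s' ∈ SQ, ∃ r : ℚ, W.cupPairing Y N (2 * p) (2 * q) h s s' = r :=
    fun s hs s' hs' ↦ W.exists_rat_cupPairing_of_mem_ratAlgebraicClasses hY hpq h hs hs'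
  have hS : ∀ s ∈ SP, (∀ s' ∈ SQ, W.cupPairing Y N (2 * p) (2 * q) h s s' = 0) → s = 0 :=
    fun s hs hperp ↦ hD s hs hperp
  haveI : Module.Finite ℚ SP :=
    RatStructure.finite_of_isRatValued (W.cupPairing Y N (2 * p) (2 * q) h) SP SQ hrat hS
  let b := Module.finBasis ℚ SP
  have hSP : Submodule.span K (SP : Set (W.obj Y (2 * p))) = W.algebraicClasses Y p :=
    (W.algebraicClasses_eq_span_ratAlgebraicClasses p).symm
  -- `dim_ℚ Aᵖ(Y)_ℚ = dim_K (K · Aᵖ(Y))`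
  have hfr : Module.finrank ℚ SP = Module.finrank K (W.algebraicClasses Y p) := by
    rw [← hSP]
    exact RatStructure.finrank_eq_finrank_span_of_isRatValued
      (W.cupPairing Y N (2 * p) (2 * q) h) SP SQ hrat hS
  have hK : LinearIndependent K fun i ↦ (b i : W.obj Y (2 * p)) :=
    RatStructure.linearIndependent_basis_of_isRatValued _ SP SQ hrat hS b
  refine ⟨Module.finrank ℚ SP, fun i ↦ (b i : W.obj Y (2 * p)), fun i ↦ (b i).2, hK, ?_, ?_, hfr⟩
  · -- `span_K (b) = K · Aᵖ(Y)`: contained in it and of the same dimension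
    have hle : Submodule.span K (Set.range fun i ↦ (b i : W.obj Y (2 * p))) ≤
        W.algebraicClasses Y p := by
      rw [← hSP]
      exact Submodule.span_mono (Set.range_subset_iff.mpr fun i ↦ (b i).2)
    haveI := W.finite_obj hY (2 * p)
    refine Submodule.eq_of_le_of_finrank_eq hle ?_
    rw [finrank_span_eq_card hK, Fintype.card_fin, hfr]
  · -- every `ℚ`-class is a rational combination of the `b i`
    intro x hx
    refine ⟨fun i ↦ b.repr ⟨x, hx⟩ i, ?_⟩
    beta_reduce
    have hrepr := congrArg Subtype.val (b.sum_repr ⟨x, hx⟩)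
    rw [AddSubmonoidClass.coe_finsetSum, Subtype.coe_mk] at hrepr
    refine hrepr.symm.trans (Finset.sum_congr rfl fun i _ ↦ ?_)
    rw [Submodule.coe_smul, ← algebraMap_smul K (b.repr ⟨x, hx⟩ i), eq_ratCast]

end WeilCohomology

/-! ## §3 Milne 2007 Th. 1.2 (c): the `ℚ`-structure on the Tate classes -/

namespace GaloisWeilCohomology

variable {k : Type u} [Field k] {K : Type v} [Field K] [CharZero K]
  {χ : Field.absoluteGaloisGroup k →* Kˣ} (E : GaloisWeilCohomology k K χ)
variable {d : ℕ} {X : SchemeOver k}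

/-- **Tate's `I^r(X)` under (a)**: if `T^r` and `E^r` hold (`K · A^r(X) = Ker(φ_r - 1)` and the
Poincaré pairing `A^r(X)_ℚ × A^{d-r}(X)_ℚ → K` has trivial left kernel), then `ℚ`-linearly
independent rational algebraic classes in `H^{2r}(X)` are `K`-linearly independent (only `E^r` is
used). [cite: Milne2007TateFiniteFieldsAIM, §1 Th. 1.2 (a) ⟹ (c)] [cite: Tate1994, §2 Th. 2.9] -/
theorem linearIndependent_of_tate_a (hX : IsSmoothProjective d X) {r s : ℕ} (hrs : r + s = d)
    (h : 2 * r + 2 * s = 2 * d)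
    (hE : ∀ x ∈ E.ratAlgebraicClasses X r, (∀ y ∈ E.ratAlgebraicClasses X s,
        E.cupPairing X d (2 * r) (2 * s) h x y = 0) → x = 0)
    {ι : Type*} {a : ι → E.obj X (2 * r)} (ha : ∀ i, a i ∈ E.ratAlgebraicClasses X r)
    (hind : ∀ (t : Finset ι) (c : ι → ℚ), ∑ i ∈ t, ((c i : ℚ) : K) • a i = 0 → ∀ i ∈ t, c i = 0) :
    LinearIndependent K a :=
  E.linearIndependent_of_mem_ratAlgebraicClasses hX hrs h hE ha hind

variable [Finite k]

/-- **Milne 2007 Th. 1.2 (c), the `ℚ`-structure clause**: under Tate's (a) for `X` smooth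
projective of dimension `d` over a finite field and `r + s = d` — `T^r` in the form
`K · A^r(X) = Ker(φ_r - 1)` (`φ_r = χ(F)^r F` on `H^{2r}(X)`) and `E^r` — the `ℚ`-space `A^r(X)_ℚ`
of rational algebraic classes is a `ℚ`-structure on the Tate classes `𝒯^r = Ker(φ_r - 1)`:
there is a `K`-basis `a₁, …, a_m` of `Ker(φ_r - 1)` consisting of `ℚ`-algebraic classes such that
every `ℚ`-algebraic class is a rational linear combination of the `a_i`
(«`𝒜^r_ℓ(X) ⊗_ℚ ℚ_ℓ ≃ 𝒯^r_ℓ(X)`»; `m = dim_K 𝒯^r`). [cite: Milne2007TateFiniteFieldsAIM, §1 Th. 1.2 (c)]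
[cite: Tate1994, §2 Th. 2.9] [cite: Kleiman1968AlgebraicCycles, §3 Thm. 3.5] -/
theorem exists_ratBasis_ker_of_tate_a (hX : IsSmoothProjective d X) {r s : ℕ} (hrs : r + s = d)
    (h : 2 * r + 2 * s = 2 * d)
    (hT : E.algebraicClasses X r = LinearMap.ker (E.ρTwist X (2 * r) r (geomFrob k) - 1))
    (hE : ∀ x ∈ E.ratAlgebraicClasses X r, (∀ y ∈ E.ratAlgebraicClasses X s,
        E.cupPairing X d (2 * r) (2 * s) h x y = 0) → x = 0) :
    ∃ (m : ℕ) (a : Fin m → E.obj X (2 * r)), (∀ i, a i ∈ E.ratAlgebraicClasses X r) ∧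
      LinearIndependent K a ∧
      Submodule.span K (Set.range a) = LinearMap.ker (E.ρTwist X (2 * r) r (geomFrob k) - 1) ∧
      (∀ x ∈ E.ratAlgebraicClasses X r, ∃ c : Fin m → ℚ, x = ∑ i, ((c i : ℚ) : K) • a i) ∧
      m = Module.finrank K (LinearMap.ker (E.ρTwist X (2 * r) r (geomFrob k) - 1)) := by
  obtain ⟨m, a, ha, hK, hspan, hQ, hm⟩ := E.exists_ratBasis_algebraicClasses hX hrs h hE
  rw [hT] at hspan hm
  exact ⟨m, a, ha, hK, hspan, hQ, hm⟩

end GaloisWeilCohomology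

end Literature.AlgebraicGeometry.Motives

end
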